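import Summits.NavierStokesRegularity.FunctionalMining.NoGo.TopEigLaminateHeatLine
import Summits.NavierStokesRegularity.FunctionalMining.NoGo.TopEigHeatCoerciveOne
import Mathlib.MeasureTheory.Integral.DominatedConvergence
import Mathlib.MeasureTheory.Integral.IntervalIntegral.Periodic
import HarnessLib

/-!
# NO-GO K35 — no `x₂`-laminate refutes L-λ(q) for any real `q ≥ 2`: the laminate class is heat-coercive

search for candidate a priori estimates; no regularity claim.

Cell `pub-nsfunc` (NS FUNCTIONAL MINING), NOGO seat; a structural obstruction on the WITNESS CLASS of the
heat-coercivity lemma L-λ(q) (`TopEigHeatCoercive`, `@[conjecture] TopEig.TopEigHeatCoercivePos q`: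
`∃ c > 0, c·∫(λ₁⁺)^q(v) ≤ heatDissipation (∫(λ₁⁺)^q) v` on smooth divergence-free zero-mean `v : T³ → ℝ³`).
The recorded kill at `q = 1` (K32, `NoGo/TopEigHeatCoerciveOne.lean`) is an `x₂`-LAMINATE `u_F = (F(x₂),0,0)`;
at `q = 2` laminates are rigid (`TopEigLaminateTwo.laminate_rigid_two`, rate `8π²`). This file closes the
laminate door on the whole half-line `q ≥ 2`:
* `heatDissipation_lamU_eq` (`q > 2`): the **laminate dissipation identity**
  `heatDissipation (∫(λ₁⁺)^q) u_F = 2^{−q}·q(q−1)·∫₀¹|F′|^{q−2}(F″)²` (and the same for the `−λ₃` core);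
* `integral_abs_rpow_le_weighted` (`q > 2`): `∫₀¹|F′|^q ≤ (q²/16)·∫₀¹|F′|^{q−2}(F″)²` (weighted Poincaré-type
  bound via `H = |F′|^{q/2−1}F′`, which vanishes at a critical point of `F`: `sup H² ≤ ¼(∫|H′|)² ≤ ¼∫H′²`);
* `laminate_coercive` / `heatCoerciveOn_laminate` (`q ≥ 2`): `(16(q−1)/q)·∫(λ₁⁺)^q(u_F) ≤ heatDissipation`,
  i.e. `HeatCoerciveOn IsX2Laminate (∫(λ₁⁺)^q) (16(q−1)/q)`, both cores; `heatCoercivePos_laminate`: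
  **L-λ(q) restricted to the laminate class HOLDS for every real `q ≥ 2`**, and `kill_not_laminate`: a field
  with `heatDissipation < c·Φ_q`, `c ≤ 16(q−1)/q`, is NOT a laminate — a refutation of `TopEigHeatCoercivePos q`,
  `q ≥ 2`, needs a genuinely non-laminate family.

Method: convexity of the heat line (`TopEig.heatDissipation_topEigMoment_eq`: the dissipation is minus the
right derivative of `t ↦ Φ(u_F + tΔu_F) = 2^{−q}∫₀¹|F′ + tF‴|^q`, K33a `topEigMoment_line_half`), the signed
tangent inequality `|a|^q + q|a|^{q−2}a(p − a) ≤ |p|^q` at BOTH base points (a squeeze identifying the right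
derivative without differentiating under the integral; `heatLineDeriv` is continuous in `t`), one integration
by parts over the period, and the sup bound. The constant `16(q−1)/q` is not sharp (pen: `(4(q−1)/q)·μ_q`,
`π² ≤ μ_q ≤ 4π²`); `1 < q < 2` is not treated (singular weight `|F′|^{q−2}`). Kernel-checked.
RELATION TO THE GAP CLASS. On paper a laminate has `λ₂ ≡ 0`, i.e. lies in `StrainGapClass 1`, so for zero-mean
laminates the EXISTENCE of some rate at `q ≥ 2` (top core) also follows from the tree node
`TopEig.topEigGapCoercivePos_of_ge_two` (existential constant via Sobolev/Calderón–Zygmund) once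
`StrainGapClass 1 (lamU F)` is typed; this file is gap-free and explicit (identity, rate `16(q−1)/q`, both cores).
[ours] search for candidate a priori estimates; no regularity claim.
FILING (prove seat g28, REQUEST #53): declarations byte-identical to the no-go seat's staged `TopEigHeatLaminateCoercive.STAGING.lean` 0ab9f054853e9cd9; this line is the only addition.
-/

noncomputable section

open MeasureTheory Set intervalIntegral Real Filter
open scoped Topology

namespace Summit.NavierStokesRegularity.FunctionalMining

open Literature.Analysis Literature.Analysis.FunctionSpaces Literature.Analysis.FunctionSpaces.Torus
open TopEig LaminateDirection
open Literature.Analysis.FluidPDE.LeiZhang2011 (abs_rpow_mul_sq hasDerivAt_abs_rpow_sub_one_mul)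

namespace TopEigLaminate

variable (F : ShearProfile)

/-- **Signed tangent inequality for `x ↦ |x|^q`, real `q ≥ 1`**: `|a|^q + q·|a|^{q−2}a·(p − a) ≤ |p|^q`
for all real `a, p` (from K33a `tangent_le_abs_rpow` by the symmetry `a ↦ −a`). [folklore] -/
theorem signedTangent_le_abs_rpow {a p q : ℝ} (hq : 1 ≤ q) :
    |a| ^ q + q * (|a| ^ (q - 2) * a) * (p - a) ≤ |p| ^ q := by
  rcases lt_trichotomy a 0 with ha | rfl | ha
  · have h := tangent_le_abs_rpow (a := -a) (P := -p) (by linarith) hq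
    have e2 : (-a) ^ (q - 2) * a = -(-a) ^ (q - 1) := by
      rw [show q - 1 = (q - 2) + 1 by ring, rpow_add (by linarith : (0 : ℝ) < -a), rpow_one]; ring
    rw [abs_of_neg ha, e2, ← abs_neg p]
    calc (-a) ^ q + q * -(-a) ^ (q - 1) * (p - a) = (-a) ^ q + q * (-a) ^ (q - 1) * (-p - -a) := by ring
      _ ≤ |(-p)| ^ q := h
  · simp only [abs_zero, mul_zero, zero_mul, add_zero]
    rw [zero_rpow (by linarith)]; exact rpow_nonneg (abs_nonneg p) q
  · have h := tangent_le_abs_rpow (a := a) (P := p) ha.le hq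
    have e2 : a ^ (q - 2) * a = a ^ (q - 1) := by
      rw [show q - 1 = (q - 2) + 1 by ring, rpow_add ha, rpow_one]
    rw [abs_of_pos ha, e2]; exact h

/-- The formal `t`-derivative of `∫₀¹ |F′ + tF‴|^q`: `∫₀¹ q·|F′ + tF‴|^{q−2}(F′ + tF‴)·F‴`. [ours; bookkeeping] -/
def heatLineDeriv (q t : ℝ) : ℝ :=
  ∫ s in (0 : ℝ)..1, q * (|F.D s + t * F.D.D.D s| ^ (q - 2) * (F.D s + t * F.D.D.D s)) * F.D.D.D s

/-- Continuity of `s ↦ q·|P s|^{q−2}(P s)·F‴(s)` along the line `P = F′ + tF‴` (`q ≥ 2`). [ours; bookkeeping] -/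
theorem continuous_lineIntegrand {q : ℝ} (hq : 2 ≤ q) (t : ℝ) :
    Continuous fun s : ℝ =>
      q * (|F.D s + t * F.D.D.D s| ^ (q - 2) * (F.D s + t * F.D.D.D s)) * F.D.D.D s := by
  have hP : Continuous fun s : ℝ => F.D s + t * F.D.D.D s :=
    F.D.continuous.add (continuous_const.mul F.D.D.D.continuous)
  exact (continuous_const.mul ((hP.abs.rpow_const fun _ => Or.inr (by linarith)).mul hP)).mul
    F.D.D.D.continuous

/-- Continuity of `s ↦ |F′(s) + tF‴(s)|^q` (`q ≥ 0`). [ours; bookkeeping] -/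
theorem continuous_lineRpow {q : ℝ} (hq : 0 ≤ q) (t : ℝ) :
    Continuous fun s : ℝ => |F.D s + t * F.D.D.D s| ^ q :=
  (F.D.continuous.add (continuous_const.mul F.D.D.D.continuous)).abs.rpow_const fun _ => Or.inr hq

/-- **Lower tangent bound along the line** (`q ≥ 2`): `∫₀¹|F′|^q + t·J(0) ≤ ∫₀¹|F′ + tF‴|^q`,
`J = heatLineDeriv`. [ours] -/
theorem integral_heatLine_rpow_ge {q : ℝ} (hq : 2 ≤ q) (t : ℝ) :
    (∫ s in (0 : ℝ)..1, |F.D s| ^ q) + t * heatLineDeriv F q 0 ≤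
      ∫ s in (0 : ℝ)..1, |F.D s + t * F.D.D.D s| ^ q := by
  have h0 := continuous_lineIntegrand F hq 0
  have hc0 := continuous_lineRpow F (q := q) (by linarith) 0
  simp only [zero_mul, add_zero] at h0 hc0
  simp only [heatLineDeriv, zero_mul, add_zero]
  rw [← intervalIntegral.integral_const_mul, ← intervalIntegral.integral_add]
  · refine intervalIntegral.integral_mono zero_le_one
      ((hc0.add (continuous_const.mul h0)).intervalIntegrable _ _)
      ((continuous_lineRpow F (q := q) (by linarith) t).intervalIntegrable _ _) fun s => ?_
    have h := signedTangent_le_abs_rpow (a := F.D s) (p := F.D s + t * F.D.D.D s) (by linarith)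
    calc |F.D s| ^ q + t * (q * (|F.D s| ^ (q - 2) * F.D s) * F.D.D.D s)
          = |F.D s| ^ q + q * (|F.D s| ^ (q - 2) * F.D s) * (F.D s + t * F.D.D.D s - F.D s) := by ring
      _ ≤ |F.D s + t * F.D.D.D s| ^ q := h
  · exact hc0.intervalIntegrable _ _
  · exact (continuous_const.mul h0).intervalIntegrable _ _

/-- **Upper tangent bound along the line** (`q ≥ 2`): `∫₀¹|F′ + tF‴|^q ≤ ∫₀¹|F′|^q + t·J(t)`. [ours] -/
theorem integral_heatLine_rpow_le {q : ℝ} (hq : 2 ≤ q) (t : ℝ) :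
    ∫ s in (0 : ℝ)..1, |F.D s + t * F.D.D.D s| ^ q ≤
      (∫ s in (0 : ℝ)..1, |F.D s| ^ q) + t * heatLineDeriv F q t := by
  have ht := continuous_lineIntegrand F hq t
  have hc0 := continuous_lineRpow F (q := q) (by linarith) 0
  simp only [zero_mul, add_zero] at hc0
  simp only [heatLineDeriv]
  rw [← intervalIntegral.integral_const_mul, ← intervalIntegral.integral_add]
  · refine intervalIntegral.integral_mono zero_le_one
      ((continuous_lineRpow F (q := q) (by linarith) t).intervalIntegrable _ _)
      ((hc0.add (continuous_const.mul ht)).intervalIntegrable _ _) fun s => ?_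
    have h := signedTangent_le_abs_rpow (a := F.D s + t * F.D.D.D s) (p := F.D s) (by linarith)
    calc |F.D s + t * F.D.D.D s| ^ q
          ≤ |F.D s| ^ q - q * (|F.D s + t * F.D.D.D s| ^ (q - 2) * (F.D s + t * F.D.D.D s)) *
              (F.D s - (F.D s + t * F.D.D.D s)) := by linarith
      _ = |F.D s| ^ q + t * (q * (|F.D s + t * F.D.D.D s| ^ (q - 2) * (F.D s + t * F.D.D.D s)) *
              F.D.D.D s) := by ring
  · exact hc0.intervalIntegrable _ _
  · exact (continuous_const.mul ht).intervalIntegrable _ _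

/-- **`J = heatLineDeriv F q` is continuous in `t`** (`q ≥ 2`; jointly continuous integrand). [ours] -/
theorem continuous_heatLineDeriv {q : ℝ} (hq : 2 ≤ q) : Continuous fun t : ℝ => heatLineDeriv F q t := by
  have hP : Continuous fun p : ℝ × ℝ => F.D p.2 + p.1 * F.D.D.D p.2 :=
    (F.D.continuous.comp continuous_snd).add (continuous_fst.mul (F.D.D.D.continuous.comp continuous_snd))
  have hf : Continuous fun p : ℝ × ℝ =>
      q * (|F.D p.2 + p.1 * F.D.D.D p.2| ^ (q - 2) * (F.D p.2 + p.1 * F.D.D.D p.2)) * F.D.D.D p.2 :=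
    (continuous_const.mul ((hP.abs.rpow_const fun _ => Or.inr (by linarith)).mul hP)).mul
      (F.D.D.D.continuous.comp continuous_snd)
  exact intervalIntegral.continuous_parametric_intervalIntegral_of_continuous'
    (f := fun t s => q * (|F.D s + t * F.D.D.D s| ^ (q - 2) * (F.D s + t * F.D.D.D s)) * F.D.D.D s) hf 0 1

/-- **Identification of the right derivative** (`q ≥ 2`): if `M(t) = 2^{−q}∫₀¹|F′ + tF‴|^q` has right
derivative `m` at `0`, then `m = 2^{−q}·J(0)` — squeeze between the two tangent bounds, `J` continuous. [ours] -/
theorem rightDeriv_line_eq {q : ℝ} (hq : 2 ≤ q) {M : ℝ → ℝ} {m : ℝ}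
    (hline : ∀ t : ℝ, M t = (1 / 2 : ℝ) ^ q * ∫ s in (0 : ℝ)..1, |F.D s + t * F.D.D.D s| ^ q)
    (hderiv : HasDerivWithinAt M m (Set.Ioi 0) 0) :
    m = (1 / 2 : ℝ) ^ q * heatLineDeriv F q 0 := by
  have hc : 0 < (1 / 2 : ℝ) ^ q := rpow_pos_of_pos (by norm_num) q
  have hM0 : M 0 = (1 / 2 : ℝ) ^ q * ∫ s in (0 : ℝ)..1, |F.D s| ^ q := by
    rw [hline 0]; simp only [zero_mul, add_zero]
  have ht : Tendsto (slope M 0) (𝓝[Set.Ioi 0] 0) (𝓝 m) :=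
    (hasDerivWithinAt_iff_tendsto_slope' (by simp)).1 hderiv
  have hslope : ∀ t : ℝ, 0 < t → slope M 0 t =
      (1 / 2 : ℝ) ^ q * ((∫ s in (0 : ℝ)..1, |F.D s + t * F.D.D.D s| ^ q) -
        ∫ s in (0 : ℝ)..1, |F.D s| ^ q) / t := by
    intro t htp
    rw [slope_def_field, sub_zero, hline t, hM0]; ring
  have hlow : ∀ᶠ t in 𝓝[Set.Ioi 0] 0, (1 / 2 : ℝ) ^ q * heatLineDeriv F q 0 ≤ slope M 0 t := by
    refine eventually_nhdsWithin_of_forall fun t (htp : 0 < t) => ?_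
    rw [hslope t htp, le_div_iff₀ htp]
    nlinarith [integral_heatLine_rpow_ge F hq t, hc]
  have hup : ∀ᶠ t in 𝓝[Set.Ioi 0] 0, slope M 0 t ≤ (1 / 2 : ℝ) ^ q * heatLineDeriv F q t := by
    refine eventually_nhdsWithin_of_forall fun t (htp : 0 < t) => ?_
    rw [hslope t htp, div_le_iff₀ htp]
    nlinarith [integral_heatLine_rpow_le F hq t, hc]
  have hU : Tendsto (fun t : ℝ => (1 / 2 : ℝ) ^ q * heatLineDeriv F q t) (𝓝[Set.Ioi 0] 0)
      (𝓝 ((1 / 2 : ℝ) ^ q * heatLineDeriv F q 0)) :=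
    (((continuous_heatLineDeriv F hq).tendsto 0).mono_left nhdsWithin_le_nhds).const_mul _
  have key : Tendsto (slope M 0) (𝓝[Set.Ioi 0] 0) (𝓝 ((1 / 2 : ℝ) ^ q * heatLineDeriv F q 0)) :=
    tendsto_of_tendsto_of_tendsto_of_le_of_le' tendsto_const_nhds hU hlow hup
  exact tendsto_nhds_unique ht key

/-- **The dissipation of a laminate is `−2^{−q}·J(0)`** for both cores (`q ≥ 2`). [ours] -/
theorem heatDissipation_lamU_eq_neg {q : ℝ} (hq : 2 ≤ q) :
    heatDissipation (torusTopEigMoment q) (lamU F) = -((1 / 2 : ℝ) ^ q * heatLineDeriv F q 0) ∧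
      heatDissipation (torusNegBotEigMoment q) (lamU F) = -((1 / 2 : ℝ) ^ q * heatLineDeriv F q 0) := by
  have hq1 : (1 : ℝ) ≤ q := by linarith
  have hq0 : (0 : ℝ) < q := by linarith
  obtain ⟨hd1, he1⟩ := heatDissipation_topEigMoment_eq hq1 (isSmooth_lamU F)
  obtain ⟨hd2, he2⟩ := heatDissipation_negBotEigMoment_eq hq1 (isSmooth_lamU F)
  exact ⟨by rw [he1, rightDeriv_line_eq F hq (fun t => (topEigMoment_line_half F t hq0).1) hd1],
    by rw [he2, rightDeriv_line_eq F hq (fun t => (topEigMoment_line_half F t hq0).2) hd2]⟩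

/-- **`J(0) = −q(q−1)·∫₀¹ |F′|^{q−2}(F″)²`** (`q > 2`; integration by parts over a period, the odd power
`|x|^{q−2}x` being `C¹` with derivative `(q−1)|x|^{q−2}`). [ours] -/
theorem heatLineDeriv_zero {q : ℝ} (hq : 2 < q) :
    heatLineDeriv F q 0 = -(q * (q - 1)) * ∫ s in (0 : ℝ)..1, |F.D s| ^ (q - 2) * F.D.D s ^ 2 := by
  simp only [heatLineDeriv, zero_mul, add_zero]
  have hu : ∀ x : ℝ, HasDerivAt (fun s : ℝ => |F.D s| ^ (q - 2) * F.D s)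
      ((q - 1) * |F.D x| ^ (q - 2) * F.D.D x) x := by
    intro x
    have h1 := hasDerivAt_abs_rpow_sub_one_mul (p := q - 1) (by linarith) (F.D x)
    rw [show q - 1 - 1 = q - 2 by ring] at h1
    exact h1.comp x (hasDerivAt_D F.D x)
  have hu'c : Continuous fun x : ℝ => (q - 1) * |F.D x| ^ (q - 2) * F.D.D x :=
    (continuous_const.mul (F.D.continuous.abs.rpow_const fun _ => Or.inr (by linarith))).mul
      F.D.D.continuous
  have h := intervalIntegral.integral_mul_deriv_eq_deriv_mul (a := 0) (b := 1)
    (u := fun s : ℝ => |F.D s| ^ (q - 2) * F.D s) (v := (F.D.D : ℝ → ℝ))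
    (u' := fun x : ℝ => (q - 1) * |F.D x| ^ (q - 2) * F.D.D x) (v' := (F.D.D.D : ℝ → ℝ))
    (fun x _ => hu x) (fun x _ => hasDerivAt_D F.D.D x) (hu'c.intervalIntegrable _ _)
    (F.D.D.D.continuous.intervalIntegrable _ _)
  have hp1 : F.D 1 = F.D 0 := by have := F.D.periodic 0; simpa using this
  have hp2 : F.D.D 1 = F.D.D 0 := by have := F.D.D.periodic 0; simpa using this
  have e1 : ∫ s in (0 : ℝ)..1, q * (|F.D s| ^ (q - 2) * F.D s) * F.D.D.D s =
      q * ∫ s in (0 : ℝ)..1, |F.D s| ^ (q - 2) * F.D s * F.D.D.D s := by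
    rw [← intervalIntegral.integral_const_mul]
    exact intervalIntegral.integral_congr fun s _ => by ring
  have e2 : ∫ s in (0 : ℝ)..1, (q - 1) * |F.D s| ^ (q - 2) * F.D.D s * F.D.D s =
      (q - 1) * ∫ s in (0 : ℝ)..1, |F.D s| ^ (q - 2) * F.D.D s ^ 2 := by
    rw [← intervalIntegral.integral_const_mul]
    exact intervalIntegral.integral_congr fun s _ => by ring
  rw [e1, h, hp1, hp2, sub_self, zero_sub, e2]; ring

/-- **Laminate dissipation identity** (`q > 2`):
`heatDissipation (∫(λ₁⁺)^q) u_F = 2^{−q}·q(q−1)·∫₀¹|F′|^{q−2}(F″)²`, and the same for the `−λ₃` core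
(at `q = 2` this is `TopEigLaminateTwo.heatDissipation_topEigMoment_two_lamU`, `½∫F″²`). [ours] -/
theorem heatDissipation_lamU_eq {q : ℝ} (hq : 2 < q) :
    heatDissipation (torusTopEigMoment q) (lamU F) =
        (1 / 2 : ℝ) ^ q * (q * (q - 1)) * ∫ s in (0 : ℝ)..1, |F.D s| ^ (q - 2) * F.D.D s ^ 2 ∧
      heatDissipation (torusNegBotEigMoment q) (lamU F) =
        (1 / 2 : ℝ) ^ q * (q * (q - 1)) * ∫ s in (0 : ℝ)..1, |F.D s| ^ (q - 2) * F.D.D s ^ 2 := by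
  obtain ⟨h1, h2⟩ := heatDissipation_lamU_eq_neg F hq.le
  rw [h1, h2, heatLineDeriv_zero F hq]
  constructor <;> ring

/-- **`F′` has a zero**: a smooth periodic `F` attains its maximum, where `F′ = 0`. [folklore] -/
theorem exists_D_eq_zero : ∃ s₀ : ℝ, F.D s₀ = 0 := by
  obtain ⟨s₀, -, hmax⟩ :=
    isCompact_Icc.exists_isMaxOn (Set.nonempty_Icc.2 (zero_le_one' ℝ)) F.continuous.continuousOn
  have hall : ∀ x : ℝ, F x ≤ F s₀ := fun x => by
    have h1 : F (x - ⌊x⌋) = F x := by simpa using F.periodic.sub_int_mul_eq (x := x) ⌊x⌋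
    rw [← h1, Int.self_sub_floor]
    exact hmax ⟨Int.fract_nonneg x, (Int.fract_lt_one x).le⟩
  have hloc : IsLocalMax (F : ℝ → ℝ) s₀ := Filter.Eventually.of_forall hall
  exact ⟨s₀, by rw [ShearProfile.D_apply]; exact hloc.deriv_eq_zero⟩

/-- `(|a|^{q/2−1}·a)² = |a|^q` and `(|a|^{q/2−1})² = |a|^{q−2}` (`q > 2`). [folklore; bookkeeping] -/
theorem sq_abs_rpow_half (a : ℝ) {q : ℝ} (hq : 2 < q) :
    (|a| ^ (q / 2 - 1)) ^ 2 = |a| ^ (q - 2) ∧ (|a| ^ (q / 2 - 1) * a) ^ 2 = |a| ^ q := by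
  have e1 : (|a| ^ (q / 2 - 1)) ^ 2 = |a| ^ (q - 2) := by
    rw [← rpow_natCast, ← rpow_mul (abs_nonneg a)]
    congr 1; push_cast; ring
  refine ⟨e1, ?_⟩
  rw [mul_pow, e1, abs_rpow_mul_sq a (by linarith : q - 2 + 2 ≠ 0)]
  congr 1; ring

/-- **Weighted Poincaré-type bound** (`q > 2`): `∫₀¹|F′|^q ≤ (q²/16)·∫₀¹|F′|^{q−2}(F″)²` for every smooth
`1`-periodic `F` (`H = |F′|^{q/2−1}F′` vanishes at a critical point `s₀` of `F` and at `s₀ + 1`, so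
`2|H| ≤ ∫|H′|` on the period, `∫H² ≤ ¼(∫|H′|)² ≤ ¼∫H′²`, with `H² = |F′|^q`, `H′² = (q²/4)|F′|^{q−2}F″²`). [ours] -/
theorem integral_abs_rpow_le_weighted {q : ℝ} (hq : 2 < q) :
    ∫ s in (0 : ℝ)..1, |F.D s| ^ q ≤ q ^ 2 / 16 * ∫ s in (0 : ℝ)..1, |F.D s| ^ (q - 2) * F.D.D s ^ 2 := by
  obtain ⟨s₀, hs₀⟩ := exists_D_eq_zero F
  set H : ℝ → ℝ := fun s => |F.D s| ^ (q / 2 - 1) * F.D s with hH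
  set H' : ℝ → ℝ := fun s => q / 2 * |F.D s| ^ (q / 2 - 1) * F.D.D s with hH'
  have hHd : ∀ x : ℝ, HasDerivAt H (H' x) x := fun x =>
    (hasDerivAt_abs_rpow_sub_one_mul (p := q / 2) (by linarith) (F.D x)).comp x (hasDerivAt_D F.D x)
  have hH'c : Continuous H' :=
    (continuous_const.mul (F.D.continuous.abs.rpow_const fun _ => Or.inr (by linarith))).mul F.D.D.continuous
  have hHc : Continuous H :=
    (F.D.continuous.abs.rpow_const fun _ => Or.inr (by linarith)).mul F.D.continuous
  have hH0 : H s₀ = 0 := by show |F.D s₀| ^ (q / 2 - 1) * F.D s₀ = 0; rw [hs₀, mul_zero]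
  have hH1 : H (s₀ + 1) = 0 := by
    show |F.D (s₀ + 1)| ^ (q / 2 - 1) * F.D (s₀ + 1) = 0; rw [F.D.periodic s₀, hs₀, mul_zero]
  have hint : ∀ a b : ℝ, IntervalIntegrable (fun x => |H' x|) volume a b := fun a b =>
    hH'c.abs.intervalIntegrable a b
  set A : ℝ := ∫ x in s₀..s₀ + 1, |H' x| with hA
  -- sup bound on the period
  have hsq : ∀ s ∈ Icc s₀ (s₀ + 1), H s ^ 2 ≤ A ^ 2 / 4 := by
    intro s hs
    have h1 : ∫ x in s₀..s, H' x = H s - H s₀ :=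
      integral_eq_sub_of_hasDerivAt (fun x _ => hHd x) (hH'c.intervalIntegrable _ _)
    have h2 : ∫ x in s..s₀ + 1, H' x = H (s₀ + 1) - H s :=
      integral_eq_sub_of_hasDerivAt (fun x _ => hHd x) (hH'c.intervalIntegrable _ _)
    have i1 : |H s| ≤ ∫ x in s₀..s, |H' x| := by
      rw [show H s = ∫ x in s₀..s, H' x by rw [h1, hH0, sub_zero]]
      exact abs_integral_le_integral_abs hs.1
    have i2 : |H s| ≤ ∫ x in s..s₀ + 1, |H' x| := by
      rw [show |H s| = |∫ x in s..s₀ + 1, H' x| by rw [h2, hH1, zero_sub, abs_neg]]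
      exact abs_integral_le_integral_abs hs.2
    have hadd : (∫ x in s₀..s, |H' x|) + ∫ x in s..s₀ + 1, |H' x| = A :=
      integral_add_adjacent_intervals (hint _ _) (hint _ _)
    have hle : |H s| ≤ A / 2 := by linarith
    calc H s ^ 2 = |H s| ^ 2 := (sq_abs _).symm
      _ ≤ (A / 2) ^ 2 := pow_le_pow_left₀ (abs_nonneg _) hle 2
      _ = A ^ 2 / 4 := by ring
  have hH2 : ∫ x in s₀..s₀ + 1, H x ^ 2 ≤ A ^ 2 / 4 := by
    calc ∫ x in s₀..s₀ + 1, H x ^ 2 ≤ ∫ x in s₀..s₀ + 1, A ^ 2 / 4 :=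
          integral_mono_on (by linarith) ((hHc.pow 2).intervalIntegrable _ _) intervalIntegrable_const hsq
      _ = A ^ 2 / 4 := by simp
  -- `A² ≤ ∫ H′²` from `0 ≤ (|H′| − A)²`
  have hCS : A ^ 2 ≤ ∫ x in s₀..s₀ + 1, H' x ^ 2 := by
    have hpt : ∀ x : ℝ, 2 * A * |H' x| - A ^ 2 ≤ H' x ^ 2 := fun x => by
      nlinarith [sq_nonneg (|H' x| - A), sq_abs (H' x)]
    have hi : ∫ x in s₀..s₀ + 1, (2 * A * |H' x| - A ^ 2) ≤ ∫ x in s₀..s₀ + 1, H' x ^ 2 :=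
      intervalIntegral.integral_mono (by linarith)
        (((continuous_const.mul hH'c.abs).sub continuous_const).intervalIntegrable _ _)
        ((hH'c.pow 2).intervalIntegrable _ _) hpt
    have he : ∫ x in s₀..s₀ + 1, (2 * A * |H' x| - A ^ 2) = 2 * A * A - A ^ 2 := by
      rw [intervalIntegral.integral_sub, intervalIntegral.integral_const_mul, intervalIntegral.integral_const,
        show s₀ + 1 - s₀ = 1 by ring, one_smul]
      · exact (continuous_const.mul hH'c.abs).intervalIntegrable _ _
      · exact intervalIntegrable_const
    nlinarith [hi, he]
  -- back to `[0, 1]` by periodicity, and the two squares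
  have hsqH : ∀ x, H x ^ 2 = |F.D x| ^ q := fun x => (sq_abs_rpow_half (F.D x) hq).2
  have hsqH' : ∀ x, H' x ^ 2 = q ^ 2 / 4 * (|F.D x| ^ (q - 2) * F.D.D x ^ 2) := fun x => by
    simp only [hH']; rw [mul_pow, mul_pow, (sq_abs_rpow_half (F.D x) hq).1]; ring
  have hperH : Function.Periodic (fun x => |F.D x| ^ q) 1 := fun x => by
    simp only [F.D.periodic x]
  have hperW : Function.Periodic (fun x => q ^ 2 / 4 * (|F.D x| ^ (q - 2) * F.D.D x ^ 2)) 1 := fun x => by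
    simp only [F.D.periodic x, F.D.D.periodic x]
  have eH : ∫ x in s₀..s₀ + 1, H x ^ 2 = ∫ x in (0 : ℝ)..1, |F.D x| ^ q := by
    rw [intervalIntegral.integral_congr fun x _ => hsqH x, hperH.intervalIntegral_add_eq s₀ 0, zero_add]
  have eH' : ∫ x in s₀..s₀ + 1, H' x ^ 2 = q ^ 2 / 4 * ∫ x in (0 : ℝ)..1, |F.D x| ^ (q - 2) * F.D.D x ^ 2 := by
    rw [intervalIntegral.integral_congr fun x _ => hsqH' x, hperW.intervalIntegral_add_eq s₀ 0, zero_add,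
      intervalIntegral.integral_const_mul]
  rw [← eH]
  calc ∫ x in s₀..s₀ + 1, H x ^ 2 ≤ A ^ 2 / 4 := hH2
    _ ≤ (∫ x in s₀..s₀ + 1, H' x ^ 2) / 4 := by linarith
    _ = q ^ 2 / 16 * ∫ x in (0 : ℝ)..1, |F.D x| ^ (q - 2) * F.D.D x ^ 2 := by rw [eH']; ring

/-- `∫(λ₁⁺)^q(u_F) = ∫((−λ₃)⁺)^q(u_F) = 2^{−q}∫₀¹|F′|^q` (`q > 0`). [ours; bookkeeping] -/
theorem topEigMoment_lamU_half {q : ℝ} (hq : 0 < q) :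
    torusTopEigMoment q (lamU F) = (1 / 2 : ℝ) ^ q * ∫ s in (0 : ℝ)..1, |F.D s| ^ q ∧
      torusNegBotEigMoment q (lamU F) = (1 / 2 : ℝ) ^ q * ∫ s in (0 : ℝ)..1, |F.D s| ^ q := by
  simpa only [zero_smul, add_zero, zero_mul] using topEigMoment_line_half F 0 hq

/-- **LAMINATE COERCIVITY for every real `q ≥ 2`**: `(16(q−1)/q)·∫(λ₁⁺)^q(u_F) ≤ heatDissipation (∫(λ₁⁺)^q) u_F`
for every smooth `1`-periodic `F`, and the same for the `−λ₃` core (at `q = 2` from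
`TopEigLaminateTwo.laminate_rigid_two`, `8 ≤ 8π²`). [ours] -/
theorem laminate_coercive {q : ℝ} (hq : 2 ≤ q) :
    16 * (q - 1) / q * torusTopEigMoment q (lamU F) ≤ heatDissipation (torusTopEigMoment q) (lamU F) ∧
      16 * (q - 1) / q * torusNegBotEigMoment q (lamU F) ≤
        heatDissipation (torusNegBotEigMoment q) (lamU F) := by
  rcases hq.eq_or_lt with h2 | hq'
  · subst h2
    have hπ : (1 : ℝ) ≤ π ^ 2 := by nlinarith [pi_gt_three]
    obtain ⟨h1, h2⟩ := laminate_rigid_two F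
    have h01 := torusTopEigMoment_nonneg (2 : ℝ) (lamU F)
    have h02 := torusNegBotEigMoment_nonneg (2 : ℝ) (lamU F)
    constructor <;> nlinarith
  have hq0 : (0 : ℝ) < q := by linarith
  have hc : 0 < (1 / 2 : ℝ) ^ q := rpow_pos_of_pos (by norm_num) q
  have hk : 0 ≤ 16 * (q - 1) / q := div_nonneg (mul_nonneg (by norm_num) (by linarith)) hq0.le
  obtain ⟨hΦ1, hΦ2⟩ := topEigMoment_lamU_half F hq0
  obtain ⟨hD1, hD2⟩ := heatDissipation_lamU_eq F hq'
  have hP := integral_abs_rpow_le_weighted F hq'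
  have key : 16 * (q - 1) / q * ((1 / 2 : ℝ) ^ q * ∫ s in (0 : ℝ)..1, |F.D s| ^ q) ≤
      (1 / 2 : ℝ) ^ q * (q * (q - 1)) * ∫ s in (0 : ℝ)..1, |F.D s| ^ (q - 2) * F.D.D s ^ 2 := by
    calc 16 * (q - 1) / q * ((1 / 2 : ℝ) ^ q * ∫ s in (0 : ℝ)..1, |F.D s| ^ q)
          ≤ 16 * (q - 1) / q * ((1 / 2 : ℝ) ^ q *
              (q ^ 2 / 16 * ∫ s in (0 : ℝ)..1, |F.D s| ^ (q - 2) * F.D.D s ^ 2)) :=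
          mul_le_mul_of_nonneg_left (mul_le_mul_of_nonneg_left hP hc.le) hk
      _ = (1 / 2 : ℝ) ^ q * (q * (q - 1)) * ∫ s in (0 : ℝ)..1, |F.D s| ^ (q - 2) * F.D.D s ^ 2 := by
          field_simp
  exact ⟨by rw [hΦ1, hD1]; exact key, by rw [hΦ2, hD2]; exact key⟩

/-- **THE LAMINATE CLASS IS HEAT-COERCIVE FOR EVERY REAL `q ≥ 2`** (dictionary vocabulary of
`TopEigHeatCoerciveGap`): `HeatCoerciveOn IsX2Laminate (∫(λ₁⁺)^q) (16(q−1)/q)`, both cores. [ours] -/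
theorem heatCoerciveOn_laminate {q : ℝ} (hq : 2 ≤ q) :
    HeatCoerciveOn (d := Fin 3) IsX2Laminate (torusTopEigMoment q) (16 * (q - 1) / q) ∧
      HeatCoerciveOn (d := Fin 3) IsX2Laminate (torusNegBotEigMoment q) (16 * (q - 1) / q) :=
  ⟨by rintro - v - - - ⟨F, rfl⟩; exact (laminate_coercive F hq).1,
    by rintro - v - - - ⟨F, rfl⟩; exact (laminate_coercive F hq).2⟩

/-- **NO-GO K35 — L-λ(q) RESTRICTED TO THE LAMINATE CLASS HOLDS for every real `q ≥ 2`** (both cores): no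
`x₂`-laminate `u_F` refutes `TopEigHeatCoercivePos q` there (contrast K32: at `q = 1` a laminate kills it).
A refuting family for some `q ≥ 2`, if any, is genuinely non-laminate. [ours] -/
theorem heatCoercivePos_laminate {q : ℝ} (hq : 2 ≤ q) :
    (∃ c : ℝ, 0 < c ∧ HeatCoerciveOn (d := Fin 3) IsX2Laminate (torusTopEigMoment q) c) ∧
      ∃ c : ℝ, 0 < c ∧ HeatCoerciveOn (d := Fin 3) IsX2Laminate (torusNegBotEigMoment q) c :=
  have hc : 0 < 16 * (q - 1) / q := div_pos (mul_pos (by norm_num) (by linarith)) (by linarith)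
  ⟨⟨_, hc, (heatCoerciveOn_laminate hq).1⟩, ⟨_, hc, (heatCoerciveOn_laminate hq).2⟩⟩

/-- **No laminate is a kill witness** (`q ≥ 2`): `heatDissipation (∫(λ₁⁺)^q) u_F < c·∫(λ₁⁺)^q(u_F)` fails for
every `c ≤ 16(q−1)/q` and every profile `F`. [ours] -/
theorem not_laminate_kill {q : ℝ} (hq : 2 ≤ q) {c : ℝ} (hc : c ≤ 16 * (q - 1) / q) :
    ¬ heatDissipation (torusTopEigMoment q) (lamU F) < c * torusTopEigMoment q (lamU F) := by
  have h := (laminate_coercive F hq).1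
  have h0 := torusTopEigMoment_nonneg q (lamU F)
  exact not_lt.2 ((mul_le_mul_of_nonneg_right hc h0).trans h)

/-- **A kill witness for L-λ(q), `q ≥ 2`, at any rate `c ≤ 16(q−1)/q` is NOT an `x₂`-laminate.** [ours] -/
theorem kill_not_laminate {q : ℝ} (hq : 2 ≤ q) {c : ℝ} (hc : c ≤ 16 * (q - 1) / q)
    {v : UnitAddTorus (Fin 3) → EuclideanSpace ℝ (Fin 3)}
    (hv : heatDissipation (torusTopEigMoment q) v < c * torusTopEigMoment q v) : ¬ IsX2Laminate v := by
  rintro ⟨F, rfl⟩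
  exact not_laminate_kill F hq hc hv

end TopEigLaminate

end Summit.NavierStokesRegularity.FunctionalMining

end
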